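import Summits.CriticalPhenomena.CardyFormulaZ2.Theorems.CardySusyWardParafermionFamiliesToSLESixDefs
import Summits.CriticalPhenomena.CardyFormulaZ2.Theorems.CardySusyWardDiscretisationFamilyExists
import Literature.Probability.RandomPlanarGeometry.RectangleConformalMap
import Literature.Probability.RandomPlanarGeometry.ChordalCurveFamily

/-!
# The strip anchor (stub S5 of line `strip-anchored-vertex-normalisation`, crux stmt-CriticalPhenomena-10814), I:
# the anchor family and the lower asymptotics of Ikhlef–Ponsaing's strip passage probability

Helper file for `stub_anchoredWallFlux` (the strip anchor `AnchoredWallFlux`). Two closed pieces: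

* **The anchor Dobrushin domain** `anchorDomain`: the DIAGONAL square `{|x + y| < 2, |x - y| < 2}` (the
  square `(-1,1)²` turned by the similarity `z ↦ -(1+i) z`), marked at the two ends of its upper-right
  side, so that the free arc `arc 1` is EXACTLY the straight diagonal side `{x + y = 2, |x - y| ≤ 2}`
  (a window of the free wall of Ikhlef–Ponsaing's diagonal strip) and the wired arc `arc 0` is the
  union of the three other sides; `localHalfPlane_anchor`: near the midpoint `w₀ = 1 + i` of the free
  side the domain is exactly the half-plane below the lattice diagonal through `w₀` (inward normal
  `-(1+i)/√2`, radius `r ≤ 1/4`); `sqrt_two_le_dist_of_mem_arc_zero`: the wired arc stays at distance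
  `≥ √2` from `w₀`; and `exists_isFamily_anchor`: the anchor carries a discretisation family with the six
  `IsFamily` fields (the route's support theorem `DiscretisationFamilyExists_proof`, stmt-9644).
  Registered one-line form: `stub_anchor_family`.
* **The lower half of the asymptotics of `ipRatio`** (`ipRatio_lower`): Ikhlef–Ponsaing's exact strip
  passage probability `P_b(2m+1) = A_V(2m+1)A_V(2m+3)/N_8(2m+2)²` satisfies `P_b(2m+1) ≥ (2m+1)^{-1/3}`
  — the sequence `P_b(2m+1)³ (2m+1)` is NON-DECREASING (polynomial identity
  `N³(2m+3) = D³(2m+1) + Q(m)`, `Q ≥ 0` coefficientwise, for the one-step ratio `N/D` of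
  `…EdgePrecompactIpAsymptotic.lean`, whose factorial telescoping is re-derived here) and starts at `1`.
  With `stub_ipAsymptotic` (`≤ 2 (2m+1)^{-1/3}`) this pins `P_b ≍ m^{-1/3}` (IP12 Prop. 4.9: `∼ 1.137 L^{-1/3}`).
-/

noncomputable section

namespace Summit.CriticalPhenomena.CardyFormulaZ2.Theorems.ParafermionFamiliesToSLESix.StripAnchored

open MeasureTheory Filter Set Metric Complex
open scoped Topology BigOperators
open Literature.Probability.LatticeModels (DiscreteDobrushin)
open Literature.Probability.RandomPlanarGeometry
open Summit.CriticalPhenomena.CardyFormulaZ2.Cruxes.EdgePrecompact.QkzStripBoundaryArm (vsasm csscpp ipRatio)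
open Summit.CriticalPhenomena.CardyFormulaZ2.Theorems.ParafermionPrecompact.Negative (IsFamily)

namespace S5

/-! ## The lower asymptotics of `ipRatio` -/

-- adapted from `Theorems/CardyComplexConeEdgePrecompactIpAsymptotic.lean` (private lemmas there)
/-- One step of the product `vsasm`. [cite: IkhlefPonsaing2012, Prop. 4.7] -/
theorem vsasm_succ (m : ℕ) :
    vsasm (m + 1) = vsasm m *
      (((3 * m + 2 : ℕ) * (6 * m + 3).factorial * (2 * m + 1).factorial : ℝ) /
        ((4 * m + 2).factorial * (4 * m + 3).factorial : ℝ)) := by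
  unfold vsasm; rw [Finset.prod_range_succ]

/-- One step of the product `csscpp`. [cite: IkhlefPonsaing2012, Prop. 4.7] -/
theorem csscpp_succ (m : ℕ) :
    csscpp (m + 1) = csscpp m *
      (((3 * m + 1 : ℕ) * (6 * m).factorial * (2 * m).factorial : ℝ) /
        ((4 * m).factorial * (4 * m + 1).factorial : ℝ)) := by
  unfold csscpp; rw [Finset.prod_range_succ]

/-- `A_V(2m+1) > 0`. [folklore] -/
theorem vsasm_pos (m : ℕ) : 0 < vsasm m := by
  unfold vsasm; exact Finset.prod_pos fun i _ => by positivity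

/-- `N_8(2m) > 0`. [folklore] -/
theorem csscpp_pos (m : ℕ) : 0 < csscpp m := by
  unfold csscpp; exact Finset.prod_pos fun i _ => by positivity

/-- `P_b(2m+1) > 0`. [folklore] -/
theorem ipRatio_pos (m : ℕ) : 0 < ipRatio m := by
  unfold ipRatio
  have := vsasm_pos m; have := vsasm_pos (m + 1); have := csscpp_pos (m + 1)
  positivity

/-- `P_b(1) = 1`. [cite: IkhlefPonsaing2012, Prop. 4.5] -/
theorem ipRatio_zero : ipRatio 0 = 1 := by
  have h0 : vsasm 0 = 1 := by simp [vsasm]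
  have h1 : vsasm 1 = 1 := by rw [vsasm_succ, h0]; norm_num [Nat.factorial]
  have h2 : csscpp 1 = 1 := by rw [csscpp_succ]; simp [csscpp, Nat.factorial]
  simp [ipRatio, h0, h1, h2]

/-- `(n+k)!` telescoped down to `n!`, cast to `ℝ`. [folklore] -/
theorem cast_factorial_telescope (t n k : ℕ) (h : t = n + k) :
    (t.factorial : ℝ) = (∏ j ∈ Finset.range k, ((n : ℝ) + j + 1)) * n.factorial := by
  subst h
  induction k with
  | zero => simp
  | succ k ih =>
    rw [Finset.prod_range_succ, show n + (k + 1) = (n + k) + 1 from rfl, Nat.factorial_succ]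
    push_cast; rw [ih]; ring

/-- One-step ratio of `ipRatio`: `P_b(2m+3) = P_b(2m+1) · (3m+5)(6m+7)(4m+3) / ((3m+4)(6m+5)(4m+7))`.
[cite: IkhlefPonsaing2012, Prop. 4.7] -/
theorem ipRatio_succ (m : ℕ) :
    ipRatio (m + 1) = ipRatio m *
      (((3 * m + 5) * (6 * m + 7) * (4 * m + 3) : ℝ) / ((3 * m + 4) * (6 * m + 5) * (4 * m + 7))) := by
  have hv : 0 < vsasm m := vsasm_pos m
  have hc : 0 < csscpp (m + 1) := csscpp_pos (m + 1)
  have hF6 : (0 : ℝ) < (6 * m + 3).factorial := by positivity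
  have hF2 : (0 : ℝ) < (2 * m + 1).factorial := by positivity
  have hF4 : (0 : ℝ) < (4 * m + 2).factorial := by positivity
  simp only [ipRatio]
  rw [vsasm_succ (m + 1), vsasm_succ m, csscpp_succ (m + 1)]
  rw [cast_factorial_telescope (6 * (m + 1) + 3) (6 * m + 3) 6 (by ring),
    cast_factorial_telescope (6 * (m + 1)) (6 * m + 3) 3 (by ring),
    cast_factorial_telescope (2 * (m + 1) + 1) (2 * m + 1) 2 (by ring),
    cast_factorial_telescope (2 * (m + 1)) (2 * m + 1) 1 (by ring),
    cast_factorial_telescope (4 * (m + 1) + 2) (4 * m + 2) 4 (by ring),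
    cast_factorial_telescope (4 * (m + 1) + 3) (4 * m + 2) 5 (by ring),
    cast_factorial_telescope (4 * (m + 1)) (4 * m + 2) 2 (by ring),
    cast_factorial_telescope (4 * (m + 1) + 1) (4 * m + 2) 3 (by ring),
    cast_factorial_telescope (4 * m + 3) (4 * m + 2) 1 (by ring)]
  simp only [Finset.prod_range_succ, Finset.prod_range_zero]
  push_cast
  field_simp
  ring

/-- The polynomial inequality behind the monotonicity of `ipRatio m ^ 3 (2m+1)`:
`(2x+1) D³ ≤ (2x+3) N³` for `x ≥ 0` (`N³(2x+3) - D³(2x+1)` has non-negative coefficients). [folklore] -/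
theorem ipRatio_step_poly_lower (x : ℝ) (hx : 0 ≤ x) :
    (2 * x + 1) * ((3 * x + 4) * (6 * x + 5) * (4 * x + 7)) ^ 3 ≤
      ((3 * x + 5) * (6 * x + 7) * (4 * x + 3)) ^ 3 * (2 * x + 3) := by
  have hQ : 0 ≤ 728875 + 5143775 * x + 15679125 * x ^ 2 + 26955724 * x ^ 3 + 28587384 * x ^ 4 +
      19154304 * x ^ 5 + 7920720 * x ^ 6 + 1848960 * x ^ 7 + 186624 * x ^ 8 := by positivity
  have key : ((3 * x + 5) * (6 * x + 7) * (4 * x + 3)) ^ 3 * (2 * x + 3) =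
      (2 * x + 1) * ((3 * x + 4) * (6 * x + 5) * (4 * x + 7)) ^ 3 +
      (728875 + 5143775 * x + 15679125 * x ^ 2 + 26955724 * x ^ 3 + 28587384 * x ^ 4 +
        19154304 * x ^ 5 + 7920720 * x ^ 6 + 1848960 * x ^ 7 + 186624 * x ^ 8) := by ring
  nlinarith [key, hQ]

/-- Monotonicity: `P_b(2m+1)³ (2m+1) ≤ P_b(2m+3)³ (2m+3)`. [folklore] -/
theorem ipRatio_cube_succ_ge (m : ℕ) :
    ipRatio m ^ 3 * (2 * (m : ℝ) + 1) ≤ ipRatio (m + 1) ^ 3 * (2 * (m : ℝ) + 3) := by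
  have h0 : 0 ≤ ipRatio m := (ipRatio_pos m).le
  have hD : (0 : ℝ) < (3 * m + 4) * (6 * m + 5) * (4 * m + 7) := by positivity
  rw [ipRatio_succ, mul_pow, div_pow, mul_assoc]
  refine mul_le_mul_of_nonneg_left ?_ (pow_nonneg h0 3)
  rw [div_mul_eq_mul_div, le_div_iff₀ (pow_pos hD 3)]
  exact ipRatio_step_poly_lower m (Nat.cast_nonneg m)

/-- `1 ≤ P_b(2m+1)³ (2m+1)`. [folklore] -/
theorem one_le_ipRatio_cube_mul (m : ℕ) : 1 ≤ ipRatio m ^ 3 * (2 * (m : ℝ) + 1) := by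
  induction m with
  | zero => simp [ipRatio_zero]
  | succ m ih =>
    have := ipRatio_cube_succ_ge m
    push_cast
    linarith

/-- **Lower asymptotics of Ikhlef–Ponsaing's strip passage probability**: `(2m+1)^{-1/3} ≤ P_b(2m+1)`
(the elementary lower half of IP12 Prop. 4.9, constant `1`). [cite: IkhlefPonsaing2012, Prop. 4.9] -/
theorem ipRatio_lower (m : ℕ) : (2 * (m : ℝ) + 1) ^ (-(1:ℝ) / 3) ≤ ipRatio m := by
  have h0 : 0 ≤ ipRatio m := (ipRatio_pos m).le
  have ht : (0 : ℝ) < 2 * (m : ℝ) + 1 := by positivity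
  have hg := one_le_ipRatio_cube_mul m
  have hpow : ((2 * (m : ℝ) + 1) ^ (-(1:ℝ) / 3)) ^ 3 = 1 / (2 * (m : ℝ) + 1) := by
    rw [← Real.rpow_natCast ((2 * (m : ℝ) + 1) ^ (-(1:ℝ) / 3)) 3, ← Real.rpow_mul ht.le]
    norm_num [Real.rpow_neg_one, div_eq_mul_inv]
  refine le_of_pow_le_pow_left₀ (by norm_num : (3 : ℕ) ≠ 0) h0 ?_
  rw [hpow, div_le_iff₀ ht]
  linarith

/-- Lower asymptotics in `∃ c`-form (mirror of `stub_ipAsymptotic`). [cite: IkhlefPonsaing2012, Prop. 4.9] -/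
theorem exists_ipRatio_lower : ∃ c : ℝ, 0 < c ∧ ∀ m : ℕ, c * (2 * (m : ℝ) + 1) ^ (-(1:ℝ) / 3) ≤ ipRatio m :=
  ⟨1, one_pos, fun m => by rw [one_mul]; exact ipRatio_lower m⟩

/-! ## The anchor Dobrushin domain: the diagonal square with one free side -/

/-- The similarity ratio `-(1 + i)` turning the axis square `(-1,1)²` into the diagonal square. [folklore] -/
def rotC : ℂ := -(1 + I)

/-- `-(1+i) ≠ 0`. [folklore] -/
theorem rotC_ne_zero : rotC ≠ 0 := by
  simp [rotC, Complex.ext_iff]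

/-- The similarity `z ↦ -(1+i) z` as a homeomorphism of the plane. [folklore] -/
def rotHomeo : ℂ ≃ₜ ℂ := Homeomorph.mulLeft₀ rotC rotC_ne_zero

/-- `rotHomeo z = -(1+i) z`. [folklore] -/
@[simp] theorem rotHomeo_apply (z : ℂ) : rotHomeo z = rotC * z := rfl

/-- Real part of `-(1+i) z`: `im z - re z`. [folklore] -/
theorem rotC_mul_re (z : ℂ) : (rotC * z).re = z.im - z.re := by simp [rotC]; ring

/-- Imaginary part of `-(1+i) z`: `-(re z + im z)`. [folklore] -/
theorem rotC_mul_im (z : ℂ) : (rotC * z).im = -(z.re + z.im) := by simp [rotC]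

/-- The square `(-1,1)²` marked at the corners `(-1,-1)` (parameter `0`) and `(-1,1)` (parameter `3/4`):
its arc `1` is the LEFT side, its arc `0` the three other sides. [folklore] -/
def baseMarked : DobrushinDomain where
  toJordanDomain := rectDomain 1 1 one_pos one_pos
  mark := ![0, 3 / 4]
  strictMono_mark := by
    refine Fin.strictMono_iff_lt_succ.2 fun k => ?_
    fin_cases k
    norm_num
  mark_mem k := by
    fin_cases k
    · norm_num
    · norm_num

/-- **The anchor Dobrushin domain**: the diagonal square `{|x+y| < 2, |x-y| < 2}` with FREE arc (`arc 1`)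
the upper-right side `{x + y = 2}` and WIRED arc (`arc 0`) the three other sides. [folklore] -/
def anchorDomain : DobrushinDomain := baseMarked.map rotHomeo

/-- The carrier of the anchor domain, explicitly. [folklore] -/
theorem mem_anchorDomain_carrier {z : ℂ} :
    z ∈ anchorDomain.carrier ↔ |z.re + z.im| < 2 ∧ |z.re - z.im| < 2 := by
  rw [anchorDomain, MarkedDomain.carrier_map]
  change z ∈ rotHomeo '' (symRect 1 1) ↔ _
  constructor
  · rintro ⟨u, hu, rfl⟩
    rw [mem_symRect] at hu
    rw [rotHomeo_apply, rotC_mul_re, rotC_mul_im, abs_lt, abs_lt]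
    constructor <;> constructor <;> linarith [hu.1.1, hu.1.2, hu.2.1, hu.2.2]
  · rintro ⟨h1, h2⟩
    rw [abs_lt] at h1 h2
    refine ⟨⟨-(z.re + z.im) / 2, (z.re - z.im) / 2⟩, ?_, ?_⟩
    · rw [mem_symRect]; constructor <;> constructor <;> linarith [h1.1, h1.2, h2.1, h2.2]
    · apply Complex.ext <;> simp [rotC] <;> ring

/-- The base loop on its left side: `polygonLoop (rectVerts 1 1) ((3 + θ)/4) = (-1, 1 - 2θ)`. [folklore] -/
theorem baseLoop_left (θ : ℝ) (hθ : θ ∈ Icc (0:ℝ) 1) :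
    polygonLoop (rectVerts 1 1) ((3 + θ) / 4) = ⟨-1, 1 - 2 * θ⟩ := by
  have h := polygonLoop_apply_div (l := rectVerts 1 1) (k := 3) (by simp) hθ
  simp only [length_rectVerts, Nat.cast_ofNat] at h
  rw [h]
  apply Complex.ext
  · simp [rectVerts, AffineMap.lineMap_apply_module']
  · simp [rectVerts, AffineMap.lineMap_apply_module']; ring

/-- The base loop on its three other sides stays at distance `≥ 1` from `(-1, 0)`: for `t ∈ [0, 3/4]`,
`im = -1`, or `re = 1`, or `im = 1`. [folklore] -/
theorem baseLoop_arc_zero {t : ℝ} (ht : t ∈ Icc (0:ℝ) (3 / 4)) :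
    (polygonLoop (rectVerts 1 1) t).im = -1 ∨ (polygonLoop (rectVerts 1 1) t).re = 1 ∨
      (polygonLoop (rectVerts 1 1) t).im = 1 := by
  obtain ⟨h0, h1⟩ := ht
  have piece : ∀ (k : ℕ) (hk : k < 4) (θ : ℝ), θ ∈ Icc (0:ℝ) 1 →
      polygonLoop (rectVerts 1 1) ((k + θ) / 4) =
        AffineMap.lineMap ((rectVerts 1 1)[k]'(by simpa using hk))
          ((rectVerts 1 1)[(k + 1) % 4]'(by simp; omega)) θ := by
    intro k hk θ hθ
    have h := polygonLoop_apply_div (l := rectVerts 1 1) (k := k) (by simpa using hk) hθ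
    simpa only [length_rectVerts, Nat.cast_ofNat] using h
  by_cases ha : t ≤ 1 / 4
  · have e : t = ((0:ℕ) + 4 * t) / 4 := by push_cast; ring
    rw [e, piece 0 (by norm_num) (4 * t) ⟨by linarith, by linarith⟩]
    left; simp [rectVerts, AffineMap.lineMap_apply_module']
  by_cases hb : t ≤ 1 / 2
  · have e : t = ((1:ℕ) + (4 * t - 1)) / 4 := by push_cast; ring
    rw [e, piece 1 (by norm_num) (4 * t - 1) ⟨by linarith, by linarith⟩]
    right; left; simp [rectVerts, AffineMap.lineMap_apply_module']
  · have e : t = ((2:ℕ) + (4 * t - 2)) / 4 := by push_cast; ring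
    rw [e, piece 2 (by norm_num) (4 * t - 2) ⟨by linarith, by linarith⟩]
    right; right; simp [rectVerts, AffineMap.lineMap_apply_module']

/-- `nextMark 1 = 1` and `nextMark 0 = 3/4` for the base marks. [folklore] -/
theorem nextMark_base : baseMarked.nextMark 1 = 1 ∧ baseMarked.nextMark 0 = 3 / 4 := by
  constructor
  · show (if h : (1:Fin 2).val + 1 < 2 then baseMarked.mark ⟨(1:Fin 2).val + 1, h⟩ else baseMarked.mark ⟨0, by omega⟩ + 1) = 1
    simp [baseMarked]
  · show (if h : (0:Fin 2).val + 1 < 2 then baseMarked.mark ⟨(0:Fin 2).val + 1, h⟩ else baseMarked.mark ⟨0, by omega⟩ + 1) = 3 / 4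
    simp [baseMarked]

/-- **The free arc of the anchor is the straight diagonal side** `{x + y = 2, |x - y| ≤ 2}`. [folklore] -/
theorem mem_anchorDomain_arc_one {z : ℂ} :
    z ∈ anchorDomain.arc 1 ↔ z.re + z.im = 2 ∧ |z.re - z.im| ≤ 2 := by
  rw [anchorDomain, MarkedDomain.arc_map, MarkedDomain.arc, nextMark_base.1]
  change z ∈ rotHomeo '' (polygonLoop (rectVerts 1 1) '' Icc ((![0, 3 / 4] : Fin 2 → ℝ) 1) 1) ↔ _
  simp only [Matrix.cons_val_one, Matrix.cons_val_zero]
  constructor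
  · rintro ⟨u, ⟨t, ⟨ht0, ht1⟩, rfl⟩, rfl⟩
    have e : t = (3 + (4 * t - 3)) / 4 := by ring
    rw [e, baseLoop_left (4 * t - 3) ⟨by linarith, by linarith⟩, rotHomeo_apply, rotC_mul_re, rotC_mul_im]
    simp only
    refine ⟨by ring, ?_⟩
    rw [abs_le]; constructor <;> linarith
  · rintro ⟨h1, h2⟩
    rw [abs_le] at h2
    -- `z = rotC * (-1, y)` with `y = (re z - im z)/2`, parameter `θ = (1 - y)/2`
    set y : ℝ := (z.re - z.im) / 2 with hy
    refine ⟨⟨-1, y⟩, ⟨(3 + (1 - y) / 2) / 4, ⟨by linarith, by linarith⟩, ?_⟩, ?_⟩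
    · rw [baseLoop_left _ ⟨by linarith, by linarith⟩]
      apply Complex.ext
      · simp
      · simp only; ring
    · rw [rotHomeo_apply]
      apply Complex.ext
      · rw [rotC_mul_re]; simp; linarith
      · rw [rotC_mul_im]; simp; linarith

/-- The wall point: the midpoint `w₀ = 1 + i` of the free side. [folklore] -/
theorem one_add_I_mem_arc_one : (1 + I : ℂ) ∈ anchorDomain.arc 1 := by
  rw [mem_anchorDomain_arc_one]; norm_num

/-- **The wired arc stays at distance `≥ √2` from the wall point `1 + i`.** [folklore] -/
theorem sqrt_two_le_dist_of_mem_arc_zero {z : ℂ} (hz : z ∈ anchorDomain.arc 0) : Real.sqrt 2 ≤ dist z (1 + I) := by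
  rw [anchorDomain, MarkedDomain.arc_map, MarkedDomain.arc, nextMark_base.2] at hz
  change z ∈ rotHomeo '' (polygonLoop (rectVerts 1 1) '' Icc ((![0, 3 / 4] : Fin 2 → ℝ) 0) (3 / 4)) at hz
  simp only [Matrix.cons_val_zero] at hz
  obtain ⟨u, ⟨t, ht, rfl⟩, rfl⟩ := hz
  set p := polygonLoop (rectVerts 1 1) t with hp
  -- `rotC * p - (1 + I) = rotC * (p - (-1))`, and `‖rotC‖ = √2`
  have e : rotHomeo p - (1 + I) = rotC * (p + 1) := by
    rw [rotHomeo_apply]; simp only [rotC]; ring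
  have hn : ‖rotC‖ = Real.sqrt 2 := by
    rw [rotC, norm_neg]
    rw [Complex.norm_eq_sqrt_sq_add_sq]; norm_num
  rw [Complex.dist_eq, e, norm_mul, hn]
  have h1 : 1 ≤ ‖p + 1‖ := by
    rcases baseLoop_arc_zero ht with h | h | h
    · refine le_trans ?_ (Complex.abs_im_le_norm _)
      rw [Complex.add_im, Complex.one_im, h]; norm_num
    · refine le_trans ?_ (Complex.abs_re_le_norm _)
      rw [Complex.add_re, Complex.one_re, h]; norm_num
    · refine le_trans ?_ (Complex.abs_im_le_norm _)
      rw [Complex.add_im, Complex.one_im, h]; norm_num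
  have := Real.sqrt_nonneg 2
  nlinarith

/-- **Near the wall point the anchor domain is exactly the half-plane below the lattice diagonal**
through `1 + i`: `LocalHalfPlane anchorDomain (1 + i) (-(1+i)/√2) r` for `0 < r ≤ 1/4`. [folklore] -/
theorem localHalfPlane_anchor {r : ℝ} (hr : 0 < r) (hr4 : r ≤ 1 / 4) :
    LocalHalfPlane anchorDomain (1 + I) (-(1 + I) / (Real.sqrt 2 : ℂ)) r := by
  have hs : (0:ℝ) < Real.sqrt 2 := Real.sqrt_pos.2 (by norm_num)
  have hs2 : Real.sqrt 2 * Real.sqrt 2 = 2 := Real.mul_self_sqrt (by norm_num)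
  refine ⟨?_, hr, fun z hz => ?_⟩
  · rw [norm_div, norm_neg, Complex.norm_real, Real.norm_of_nonneg hs.le, Complex.norm_eq_sqrt_sq_add_sq]
    norm_num
  -- the normal coordinate: `Re((z - w₀)·n̄) = -((re z - 1) + (im z - 1))/√2`
  have hconj : (starRingEnd ℂ) (-(1 + I) / (Real.sqrt 2 : ℂ)) = -(1 - I) / (Real.sqrt 2 : ℂ) := by
    rw [map_div₀, map_neg, map_add, map_one, Complex.conj_I, Complex.conj_ofReal, sub_eq_add_neg]
  have hre : ((z - (1 + I)) * (starRingEnd ℂ) (-(1 + I) / (Real.sqrt 2 : ℂ))).re =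
      -((z.re - 1) + (z.im - 1)) / Real.sqrt 2 := by
    rw [hconj]
    have : (z - (1 + I)) * (-(1 - I) / (Real.sqrt 2 : ℂ)) = ((z - (1 + I)) * (-(1 - I))) / (Real.sqrt 2 : ℂ) := by ring
    rw [this, Complex.div_ofReal_re]
    congr 1
    simp; ring
  rw [mem_anchorDomain_carrier, hre]
  -- in the ball `|z - w₀| < 4r ≤ 1` the other three constraints are automatic
  rw [Metric.mem_ball, Complex.dist_eq] at hz
  have hzr : |(z - (1 + I)).re| < 1 := lt_of_le_of_lt (Complex.abs_re_le_norm _) (by linarith)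
  have hzi : |(z - (1 + I)).im| < 1 := lt_of_le_of_lt (Complex.abs_im_le_norm _) (by linarith)
  simp only [Complex.sub_re, Complex.add_re, Complex.one_re, Complex.I_re, add_zero, Complex.sub_im,
    Complex.add_im, Complex.one_im, Complex.I_im, zero_add] at hzr hzi
  rw [abs_lt] at hzr hzi
  constructor
  · rintro ⟨h1, -⟩
    rw [abs_lt] at h1
    rw [lt_div_iff₀ hs, zero_mul]; linarith
  · intro h
    rw [lt_div_iff₀ hs, zero_mul] at h
    refine ⟨?_, ?_⟩ <;> rw [abs_lt] <;> constructor <;> linarith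

/-- **The anchor carries a discretisation family** with the six `IsFamily` fields
(`DiscretisationFamilyExists`, stmt-CriticalPhenomena-9644). [folklore] -/
theorem exists_isFamily_anchor : ∃ Λ : ℝ → DiscreteDobrushin, IsFamily anchorDomain Λ := by
  obtain ⟨Λ, h1, h2, h3, h4, h5, h6⟩ := Summit.CriticalPhenomena.CardyFormulaZ2.Theorems.DiscretisationFamilyExists_proof anchorDomain
  exact ⟨Λ, h1, h2, h3, h4, h5, h6⟩

end S5

open S5 in
/-- **Registered one-line form `stub_anchor_family`** (helper of stub S5 `stub_anchoredWallFlux`): there is a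
Dobrushin domain with an `IsFamily` discretisation family and a straight piece of FREE wall along the lattice
diagonal — `LocalHalfPlane D (1+i) (-(1+i)/√2) (1/4)`, the wall point `1 + i` on the free arc `arc 1`, the
wired arc `arc 0` at distance `≥ √2` from it. [folklore] -/
theorem stub_anchor_family : ∃ (D : DobrushinDomain) (Λ : ℝ → DiscreteDobrushin), IsFamily D Λ ∧ LocalHalfPlane D (1 + Complex.I) (-(1 + Complex.I) / (Real.sqrt 2 : ℂ)) (1 / 4) ∧ (1 + Complex.I) ∈ D.arc 1 ∧ ∀ z ∈ D.arc 0, Real.sqrt 2 ≤ dist z (1 + Complex.I) := by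
  obtain ⟨Λ, hΛ⟩ := exists_isFamily_anchor
  exact ⟨anchorDomain, Λ, hΛ, localHalfPlane_anchor (by norm_num) le_rfl, one_add_I_mem_arc_one,
    fun z hz => sqrt_two_le_dist_of_mem_arc_zero hz⟩

end Summit.CriticalPhenomena.CardyFormulaZ2.Theorems.ParafermionFamiliesToSLESix.StripAnchored

end
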